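import Summits.BirchSwinnertonDyer.BirchSwinnertonDyer.Theorems.ClassRecordThreeEulerHalvesAtThreeCartanTorusCubeCutPSModPhi
import HarnessLib

/-!
# Crux 23422 line `cartan` v9, stub (F2a), PRINCIPAL-SERIES half of the torus-cube cut — the STEINBERG HYPERPLANE `W = Φ̄(𝔽₃^{P¹}) ⊂ X̄`:
# `ρ̄`-stable, simple, of codimension one (`finrank W + 1 = d`)

Seat `bsd-stepL-tam3-p1` g21 (LINE OWNER of crux 23422; `--supports stmt-BirchSwinnertonDyer-23422 --as helper`). Third file of the
construction of the mod-3 line: with `Φ̄ = Phi 𝓛 f₀` (`…PSModPhi`) for a phantom Borel-fixed vector `f₀ ∉ 3X` (`…PSModPhantom`),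
`W 𝓛 f₀ := range Φ̄` satisfies the hypotheses of cartan-f2a g0's transfer theorems (`…PSModThree`): `W_stable` (`hW`), `W_simple`
(`hsimpleW`, from the Steinberg engine), `finrank_W_add_one` (`hdim`: `finrank W = finrank I₀ = q` by injectivity on `I₀`, and
`d = χ_W(1) = q + 1`), `W_ne_top`. The trivial quotient action, `hND` and `hcube` follow in the next file.
HONEST FRAMING: linear algebra over `𝔽₃` on one lattice; S-K1′ is NOT proved here; no summit statement, no route item and no registered
stub is proved; BSD is proved for no curve. [folklore]
-/

namespace Summit.BirchSwinnertonDyer.BirchSwinnertonDyer.Theorems.CartanTorusCubeCut.PSMod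

open Summit.BirchSwinnertonDyer.BirchSwinnertonDyer.Theorems.CartanDegree
open Summit.BirchSwinnertonDyer.BirchSwinnertonDyer.Theorems.CartanTorusCubeCut
open Summit.BirchSwinnertonDyer.BirchSwinnertonDyer.Theorems.CartanTorusCubeCut.Steinberg
open scoped LinearAlgebra.Projectivization

set_option linter.dupNamespace false
set_option autoImplicit false

noncomputable section

open scoped Classical

variable {q : ℕ} [Fact q.Prime]

/-! ### The augmentation module `I₀ = ker tot` and its dimension -/

/-- `tot` as a linear functional. -/
def totLin : (P1 q → ZMod 3) →ₗ[ZMod 3] ZMod 3 where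
  toFun := tot
  map_add' := tot_add
  map_smul' := tot_smul

/-- the augmentation module `I₀ = {tot = 0}`. -/
def I0 : Submodule (ZMod 3) (P1 q → ZMod 3) := LinearMap.ker (totLin (q := q))

/-- membership in `I₀`. -/
theorem mem_I0 (c : P1 q → ZMod 3) : c ∈ (I0 : Submodule (ZMod 3) (P1 q → ZMod 3)) ↔ tot c = 0 := LinearMap.mem_ker

/-- `finrank (P¹ → 𝔽₃) = q + 1`. -/
theorem finrank_fun_P1 : Module.finrank (ZMod 3) (P1 q → ZMod 3) = q + 1 := by
  haveI : Fintype (P1 q) := Fintype.ofEquiv _ optEquiv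
  rw [Module.finrank_fintype_fun_eq_card, ← Fintype.card_congr optEquiv, Fintype.card_option, ZMod.card]

/-- `finrank I₀ = q`. -/
theorem finrank_I0 : Module.finrank (ZMod 3) (I0 : Submodule (ZMod 3) (P1 q → ZMod 3)) = q := by
  have hsurj : LinearMap.range (totLin (q := q)) = ⊤ := by
    rw [eq_top_iff]
    intro a _
    refine ⟨a • ind inf, ?_⟩
    show tot (a • ind inf) = a
    rw [tot_smul, tot_ind, mul_one]
  have h := LinearMap.finrank_range_add_finrank_ker (totLin (q := q))
  rw [hsurj, finrank_top, Module.finrank_self, finrank_fun_P1] at h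
  rw [I0]; omega

omit [Fact q.Prime] in
/-- `d = q + 1` in the principal-series case (`χ_W(1) = q + 1`). -/
theorem d_eq (𝓛 : CartanTorusLattice q) (h1 : q % 3 = 1) : 𝓛.d = q + 1 := by
  have h := PS.d_eq_char_one 𝓛
  rw [cubicNewvectorChar, Units.val_one, PS.charMat_of_isScalar PS.isScalarMat_one, if_pos h1] at h
  exact_mod_cast h

section W
variable (𝓛 : CartanTorusLattice q) (f₀ : Fin 𝓛.d → ℤ)
variable (hstab : ∀ g : G q, (g : Mat q) 1 0 = 0 → ThreeDvd (𝓛.ρ g f₀ - f₀))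

/-- **the Steinberg hyperplane** `W = range Φ̄`. -/
def W : Submodule (ZMod 3) (Fin 𝓛.d → ZMod 3) := LinearMap.range (Phi 𝓛 f₀)

/-- the generators `v̄_p` lie in `W`. -/
theorem vbar_mem_W (p : P1 q) : vbar 𝓛 f₀ p ∈ W 𝓛 f₀ := ⟨ind p, Phi_ind 𝓛 f₀ p⟩

include hstab

/-- **`hW`**: `W` is `ρ̄`-stable. -/
theorem W_stable : ∀ g : G q, ∀ w ∈ W 𝓛 f₀, PS.redEnd 𝓛.d (𝓛.ρ g) w ∈ W 𝓛 f₀ := by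
  rintro g w ⟨c, rfl⟩
  exact ⟨tr g c, (redEnd_rho_Phi 𝓛 f₀ hstab g c).symm⟩

/-- `W = Φ̄(I₀)` (`3 ∤ q + 1`: `Φ̄ c = Φ̄(c − tot c/(q+1)·𝟙)`). -/
theorem W_eq_map_I0 (hq3 : ¬ 3 ∣ q + 1) : W 𝓛 f₀ = (I0 : Submodule (ZMod 3) (P1 q → ZMod 3)).map (Phi 𝓛 f₀) := by
  have hq1 := natCast_add_one_ne_zero (q := q) hq3
  apply le_antisymm
  · rintro w ⟨c, rfl⟩
    refine ⟨c - (tot c * ((q : ZMod 3) + 1)⁻¹) • one, ?_, Phi_sub_smul_one 𝓛 f₀ hstab c _⟩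
    rw [SetLike.mem_coe, mem_I0, sub_eq_add_neg, ← neg_smul, tot_add, tot_smul_one]
    field_simp
    ring
  · rintro w ⟨c, -, rfl⟩
    exact ⟨c, rfl⟩

/-- **`finrank W = q`** (`Φ̄` is injective on `I₀`). -/
theorem finrank_W (hq3 : ¬ 3 ∣ q + 1) (hf0 : ¬ ThreeDvd f₀) : Module.finrank (ZMod 3) (W 𝓛 f₀) = q := by
  rw [W_eq_map_I0 𝓛 f₀ hstab hq3]
  have hinj : Function.Injective ((Phi 𝓛 f₀).comp (I0 (q := q)).subtype) := by
    rw [← LinearMap.ker_eq_bot, eq_bot_iff]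
    rintro ⟨c, hc⟩ h
    rw [LinearMap.mem_ker, LinearMap.comp_apply, Submodule.subtype_apply] at h
    rw [Submodule.mem_bot, Subtype.ext_iff]
    exact Phi_injective_on_aug 𝓛 f₀ hstab hq3 hf0 c ((mem_I0 c).1 hc) h
  have h := LinearMap.finrank_range_of_inj hinj
  rw [LinearMap.range_comp, Submodule.range_subtype] at h
  rw [h, finrank_I0]

/-- **`hdim`**: `finrank W + 1 = d`. -/
theorem finrank_W_add_one (h1 : q % 3 = 1) (hq3 : ¬ 3 ∣ q + 1) (hf0 : ¬ ThreeDvd f₀) :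
    Module.finrank (ZMod 3) (W 𝓛 f₀) + 1 = 𝓛.d := by
  rw [finrank_W 𝓛 f₀ hstab hq3 hf0, d_eq 𝓛 h1]

/-- **`hne`**: `W ≠ ⊤`. -/
theorem W_ne_top (h1 : q % 3 = 1) (hq3 : ¬ 3 ∣ q + 1) (hf0 : ¬ ThreeDvd f₀) : W 𝓛 f₀ ≠ ⊤ := by
  intro h
  have := finrank_W 𝓛 f₀ hstab hq3 hf0
  rw [h, finrank_top, Module.finrank_fin_fun, d_eq 𝓛 h1] at this
  omega

/-- **`hsimpleW`**: `W` is a simple `𝔽₃[G]`-module (from the Steinberg engine). -/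
theorem W_simple (hq3 : ¬ 3 ∣ q + 1) :
    ∀ W' : Submodule (ZMod 3) (Fin 𝓛.d → ZMod 3),
      (∀ g : G q, ∀ w ∈ W', PS.redEnd 𝓛.d (𝓛.ρ g) w ∈ W') → W' ≤ W 𝓛 f₀ → (W' = ⊥ ∨ W' = W 𝓛 f₀) := by
  intro W' hW'G hW'le
  -- the preimage of `W'` in `I₀`
  let N : Submodule (ZMod 3) (P1 q → ZMod 3) :=
    { carrier := {c | tot c = 0 ∧ Phi 𝓛 f₀ c ∈ W'}
      add_mem' := by
        rintro a b ⟨ha, ha'⟩ ⟨hb, hb'⟩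
        exact ⟨by rw [tot_add, ha, hb, add_zero], by rw [map_add]; exact W'.add_mem ha' hb'⟩
      zero_mem' := ⟨by simp [tot], by rw [map_zero]; exact W'.zero_mem⟩
      smul_mem' := by
        rintro a b ⟨hb, hb'⟩
        exact ⟨by rw [tot_smul, hb, mul_zero], by rw [map_smul]; exact W'.smul_mem a hb'⟩ }
  have hN : ∀ g : G q, ∀ f ∈ N, tr g f ∈ N := by
    rintro g f ⟨hf, hf'⟩
    exact ⟨by rw [tot_tr, hf], by rw [← redEnd_rho_Phi 𝓛 f₀ hstab]; exact hW'G g _ hf'⟩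
  have hN0 : ∀ f ∈ N, tot f = 0 := fun f hf => hf.1
  by_cases hne : ∃ f ∈ N, f ≠ 0
  · right
    have hall := steinberg_augmentation_simple hq3 N hN hN0 hne
    apply le_antisymm hW'le
    rw [W_eq_map_I0 𝓛 f₀ hstab hq3]
    rintro w ⟨c, hc, rfl⟩
    exact (hall c ((mem_I0 c).1 hc)).2
  · left
    push Not at hne
    rw [eq_bot_iff]
    intro w hw
    have hwW : w ∈ W 𝓛 f₀ := hW'le hw
    rw [W_eq_map_I0 𝓛 f₀ hstab hq3] at hwW
    obtain ⟨c, hc, rfl⟩ := hwW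
    have := hne c ⟨(mem_I0 c).1 hc, hw⟩
    rw [Submodule.mem_bot, this, map_zero]

end W

end

end Summit.BirchSwinnertonDyer.BirchSwinnertonDyer.Theorems.CartanTorusCubeCut.PSMod
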